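import Literature.NumberTheory.EllipticCurves.Kato2004.LocalIwasawaCohomology
import Literature.NumberTheory.EllipticCurves.IwasawaTwistModPShapiroConj
import Literature.NumberTheory.GaloisRepresentations.ConjugationDescent
import HarnessLib

/-!
# Kato 2004 (Astérisque 295) §12.2 / Lemma 17.9 / (17.13.3): FUNCTORIALITY of the local Iwasawa
# cohomology `𝐇¹_loc(T)` in the representation `T` (`LocalIwasawaH1Data.map`), and the ordinary
# sub-representation `T' = F⁺_v T_pE` of the local Tate module with the induced map
# `𝐇¹_loc(T') → 𝐇¹_loc(T)` (RECUT memo d2d9bf4ff133 §1, carrier C2: "the induced maps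
# `H¹_Iw(ℚ_{2,∞}, F⁺T) → H¹_Iw(ℚ_{2,∞}, T) → …`")

Topic `NumberTheory/EllipticCurves`, sub-directory `Kato2004` (namespace = path); companion of
`LocalIwasawaCohomology.lean` (definition seat `bsd-2adic-defn-c1`, cell `pub/bsd-2adic`, crux
`OrdLambdaHalfAtTwo` = item 19556, line `kato_determinant_greenberg_two`).  HONEST FRAMING: definitions
with bodies and proved theorems only; no named fact, no instance, no notation, no `sorry`; nothing is
specific to `p = 2`; BSD is not proved by any of this.

## The printed statements (K. Kato, Astérisque 295 (2004); store `paper:doi-10-24033-ast-639`)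

* **Lemma 17.9 [p. 275]** "Assume `f` has good ordinary reduction at `λ`, let `T, T', T''` be as in
  17.2 … Then the image of `lim← H¹_f(ℚ_p(ζ_{p^n}), T(r))` in `𝐇¹_loc(T(r))` coincides with the image
  of `𝐇¹_loc(T'(r))`."  **(17.13.3) [p. 279]** "`lim←_n H¹_f(ℚ_p(ζ_{p^n}), T(r))(k−r) ≅ 𝐇¹_loc(T'(k))`
  where `T' = T ∩ V'_{F_λ}(f*)`."  So Kato USES the map `𝐇¹_loc(T') → 𝐇¹_loc(T)` induced by the
  inclusion of the ordinary sub-lattice `T' ⊂ T` — the functoriality of `𝐇¹_loc = lim← H¹(ℚ_p(ζ_{p^n}), ·)`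
  in the coefficients (§12.2), which is what this file types, for the `Δ`-trivial tower of
  `LocalIwasawaCohomology.lean` (READING there).
* Functoriality of `H¹` and of the corestriction in the coefficients: Serre, *Galois Cohomology* I §2.4
  (compatible pairs; `cor` is a morphism of cohomological functors), NSW I §5 — in the tree:
  `cohomologyMap`, `cohomologyMap_coresLe` (`IwasawaTwistModPShapiroCores.lean`), `cohomologyMap_conjMap`
  (`ConjugationDescent.lean`).

## What is here

§1 (generic) `restrictHomOfLe_subgroupRepHom`: the tree's restriction `subgroupRepHom u H : X|_H ⟶ Y|_H`
of a `G`-morphism `u : X ⟶ Y` (`IwasawaTwistModPShapiroConj.lean`) is compatible with `restrictHomOfLe`.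
§2 For two `p`-adic representations `T₁, T₂` of `Γ_{ℚ_v}` and a `Γ_{ℚ_v}`-morphism `u : T₁ ⟶ T₂`:
`layerMap u n : H¹(ℚ_{n,v}, T₁) → H¹(ℚ_{n,v}, T₂)`, commuting with the local trace maps
(`layerMap_localLayerCores`) and with the action of `Γ_{ℚ_v}` (`layerMap_localLayerConj`); for pinned
data `J₁ : LocalIwasawaH1Data κ v T₁ γ`, `J₂ : LocalIwasawaH1Data κ v T₂ γ` **`J₁.map J₂ u : J₁.H →ₗ[Λ]
J₂.H`**, the unique map with `J₂.proj n (map x) = layerMap u n (J₁.proj n x)` (`proj_map`, `map_unique`,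
`map_id_apply`, `map_comp_apply`),
`Λ`-linear because both `Λ`-actions are levelwise (`LocalIwasawaH1Data.proj_smul`) and `layerMap`
intertwines the level operators — no topology.
§3 **`tateLocalOrdinaryRep W p v : GaloisRep ℚ_v ℤ_[p] (F⁺_v T_pW)`** — the sub-representation of the
local Tate representation `(T_pW)|_{Γ_{ℚ_v}}` on `tateModuleFilAt W p v = T_p(E₁(ℚ̄_v))` (the tree's
`ContinuousRep.subrepresentation`; stability `tateRep_toLocal_mem_tateModuleFilAt`), the inclusion
`tateLocalOrdinaryInclusion : T' ⟶ T`, and **`LocalIwasawaH1Data.ordinaryInclusion J' J : J'.H →ₗ[Λ]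
J.H`** = `𝐇¹_loc(T') → 𝐇¹_loc(T)` of Lemma 17.9 / (17.13.3) (its image is Kato's
`lim← H¹_f(ℚ_{n,p}, T)` at good ordinary `p` — a THEOREM (Lemma 17.9) not asserted here).

NOT here: injectivity of `𝐇¹_loc(T') → 𝐇¹_loc(T)`, the quotient `F⁻ = T/T'` as a representation and
`𝐇¹_loc(T) → 𝐇¹_loc(F⁻)`, exactness, Lemma 17.9 itself, Coleman maps; any fact.

## References

* K. Kato, Astérisque 295 (2004): §12.2 (p. 220), 17.2 (pp. 272–273), Lemma 17.9 (p. 275), §17.13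
  (17.13.3) (p. 279). [Kato2004Asterisque]
* J.-P. Serre, *Galois Cohomology* (1997), I §2.4. [SerreGaloisCohomology1997]
* J. Neukirch, A. Schmidt, K. Wingberg, *Cohomology of Number Fields* (2008), I §5. [NeukirchSchmidtWingberg2008]
* J.-P. Serre, *Local Fields* (1979), VII §5. [SerreLocalFields1979]
* Tree: `Kato2004/LocalIwasawaCohomology.lean`, `IwasawaTwistModPShapiroCores.lean` (`restrictHomOfLe`,
  `cohomologyMap_coresLe`), `IwasawaTwistModPShapiroConj.lean` (`subgroupRepHom`),
  `GaloisRepresentations/ConjugationDescent.lean` (`cohomologyMap_conjMap`),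
  `GaloisRepresentations/GaloisCohomology.lean` (`ContinuousRep.subrepresentation`).
-/

noncomputable section

open scoped NumberField
open Field IsDedekindDomain CategoryTheory Polynomial
open Literature.NumberTheory.GaloisRepresentations
open Literature.NumberTheory.EllipticCurves Literature.NumberTheory.EllipticCurves.Kato2004
open Literature.NumberTheory.EllipticCurves.Kato2004.EulerSystemValues
open Literature.NumberTheory.EllipticCurves.CyclotomicLayer (layerGroup isOpen_layerGroup
  normal_layerGroup)

namespace Literature.NumberTheory.EllipticCurves.Kato2004

/-! ## §1 Restricting a morphism of representations to a subgroup (generic)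

The restriction `subgroupRepHom u H : X|_H ⟶ Y|_H` of a `G`-morphism `u : X ⟶ Y` is the tree's
(`IwasawaTwistModPShapiroConj.lean`, with `subgroupRepHom_hom_apply`); here only its compatibility with
`restrictHomOfLe`. -/

section SubgroupHom

variable {k : Type} [CommRing k] [TopologicalSpace k] {G : Type} [Group G] {X Y : TopRep.{0} k G}

/-- Restricting `u|_{H'}` further to `H ≤ H'` (`restrictHomOfLe`) gives `u|_H`.
[cite: SerreGaloisCohomology1997, I §2.4] -/
theorem restrictHomOfLe_subgroupRepHom (u : X ⟶ Y) {H H' : Subgroup G} (h : H ≤ H') :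
    restrictHomOfLe h (subgroupRepHom u H') = subgroupRepHom u H := rfl

end SubgroupHom

/-! ## §2 Functoriality of `𝐇¹_loc` in the representation -/

section Map

variable {p : ℕ} [Fact p.Prime] (κ : ZpExtension ℚ p) (v : HeightOneSpectrum (𝓞 ℚ))
  {M₁ M₂ : Type} [AddCommGroup M₁] [Module ℤ_[p] M₁] [TopologicalSpace M₁] [IsTopologicalAddGroup M₁]
  [ContinuousSMul ℤ_[p] M₁] [AddCommGroup M₂] [Module ℤ_[p] M₂] [TopologicalSpace M₂]
  [IsTopologicalAddGroup M₂] [ContinuousSMul ℤ_[p] M₂]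
  {T₁ : GaloisRep (v.adicCompletion ℚ) ℤ_[p] M₁} {T₂ : GaloisRep (v.adicCompletion ℚ) ℤ_[p] M₂}
  (u : T₁.toTopRep ⟶ T₂.toTopRep)

/-- The map `H¹(ℚ_{n,v}, T₁) → H¹(ℚ_{n,v}, T₂)` induced on the `n`-th local layer by a
`Γ_{ℚ_v}`-morphism `u : T₁ ⟶ T₂` (the tree's `cohomologyMap` of `u|_{U_n}`).
[cite: SerreGaloisCohomology1997, I §2.4] -/
def layerMap (n : ℕ) : H1 T₁ (layerGroup κ v n) ⟶ H1 T₂ (layerGroup κ v n) :=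
  cohomologyMap (subgroupRepHom u (layerGroup κ v n)) 1

/-- **`H¹(u)` commutes with the local trace maps** (`cor` is a morphism of cohomological functors;
the tree's `cohomologyMap_coresLe`). [cite: SerreGaloisCohomology1997, I §2.4] [cite: NeukirchSchmidtWingberg2008, I §5] -/
theorem layerMap_localLayerCores (n : ℕ) (y : H1 T₁ (layerGroup κ v (n + 1))) :
    layerMap κ v u n (localLayerCores κ v T₁ n y) =
      localLayerCores κ v T₂ n (layerMap κ v u (n + 1) y) := by
  letI := localLayerFintypeQuot κ v n (n + 1)
  rw [localLayerCores_eq_coresLe κ v T₁ n, localLayerCores_eq_coresLe κ v T₂ n, layerMap, layerMap,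
    cohomologyMap_coresLe (layerGroup_antitone κ v (Nat.le_succ n)) (isOpen_layerGroup κ v (n + 1))
      (subgroupRepHom u (layerGroup κ v n)) y, restrictHomOfLe_subgroupRepHom]

/-- **`H¹(u)` commutes with the action of `Γ_{ℚ_v}`** on the local layers (`u` is
`Γ_{ℚ_v}`-equivariant; the tree's `cohomologyMap_conjMap`). [cite: SerreLocalFields1979, VII §5] -/
theorem layerMap_localLayerConj (n : ℕ) (g : absoluteGaloisGroup (v.adicCompletion ℚ))
    (y : H1 T₁ (layerGroup κ v n)) :
    layerMap κ v u n (localLayerConj κ v T₁ n g y) = localLayerConj κ v T₂ n g (layerMap κ v u n y) := by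
  haveI := normal_layerGroup κ v n
  rw [localLayerConj_eq, localLayerConj_eq, layerMap]
  exact cohomologyMap_conjMap (layerGroup κ v n) (subgroupRepHom u (layerGroup κ v n))
    (subgroupRepHom u (layerGroup κ v n)) g (fun m ↦ by
      rw [subgroupRepHom_hom_apply, subgroupRepHom_hom_apply, TopRep.hom_comm_apply u,
        ρ_inv_apply_ρ_apply]) 1 y

/-- `H¹(𝟙)_n = id` on the local layers. [cite: SerreGaloisCohomology1997, I §2.4] -/
theorem layerMap_id_apply (n : ℕ) (y : H1 T₁ (layerGroup κ v n)) :
    layerMap κ v (𝟙 T₁.toTopRep) n y = y := by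
  obtain ⟨c, rfl⟩ := oneCocycleClass_surjective _ y
  rw [layerMap, cohomologyMap_oneCocycleClass]
  exact congrArg _ (Subtype.ext (ContinuousMap.ext fun g ↦ by
    rw [pullback_id_resIdHom_apply, subgroupRepHom_hom_apply]; rfl))

/-- `H¹(u ≫ u')_n = H¹(u')_n ∘ H¹(u)_n` on the local layers. [cite: SerreGaloisCohomology1997, I §2.4] -/
theorem layerMap_comp_apply {M₃ : Type} [AddCommGroup M₃] [Module ℤ_[p] M₃] [TopologicalSpace M₃]
    [IsTopologicalAddGroup M₃] [ContinuousSMul ℤ_[p] M₃] {T₃ : GaloisRep (v.adicCompletion ℚ) ℤ_[p] M₃}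
    (u' : T₂.toTopRep ⟶ T₃.toTopRep) (n : ℕ) (y : H1 T₁ (layerGroup κ v n)) :
    layerMap κ v (u ≫ u') n y = layerMap κ v u' n (layerMap κ v u n y) := by
  obtain ⟨c, rfl⟩ := oneCocycleClass_surjective _ y
  rw [layerMap, layerMap, layerMap, cohomologyMap_oneCocycleClass, cohomologyMap_oneCocycleClass,
    cohomologyMap_oneCocycleClass]
  exact congrArg _ (Subtype.ext (ContinuousMap.ext fun g ↦ by
    rw [pullback_id_resIdHom_apply, pullback_id_resIdHom_apply, pullback_id_resIdHom_apply,
      subgroupRepHom_hom_apply, subgroupRepHom_hom_apply, subgroupRepHom_hom_apply]; rfl))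

variable {κ v} {γ : absoluteGaloisGroup (v.adicCompletion ℚ)}
  (J₁ : LocalIwasawaH1Data κ v T₁ γ) (J₂ : LocalIwasawaH1Data κ v T₂ γ)

namespace LocalIwasawaH1Data

/-- The levelwise images `(H¹(u)_n (proj n x))_n` of an element of `𝐇¹_loc(T₁)`.
[cite: Kato2004Asterisque, §12.2 (p. 220)] -/
def mapFamily (x : J₁.H) : ∀ n : ℕ, H1 T₂ (layerGroup κ v n) :=
  fun n ↦ layerMap κ v u n (J₁.proj n x)

/-- Unfolding `mapFamily`. [cite: Kato2004Asterisque, §12.2 (p. 220)] -/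
@[simp] theorem mapFamily_apply (x : J₁.H) (n : ℕ) :
    J₁.mapFamily u x n = layerMap κ v u n (J₁.proj n x) := rfl

/-- The levelwise images form a norm-compatible family (`layerMap_localLayerCores`, `cores_proj`).
[cite: Kato2004Asterisque, §12.2 (p. 220)] -/
theorem isLocalNormCompatible_mapFamily (x : J₁.H) :
    IsLocalNormCompatible κ v T₂ (J₁.mapFamily u x) := fun n ↦ by
  rw [mapFamily_apply, mapFamily_apply, ← layerMap_localLayerCores κ v u, J₁.cores_proj]

/-- `H¹(u)_n` intertwines the level operators `conj_γ − 1` of the two pins.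
[cite: SerreLocalFields1979, VII §5] -/
theorem layerMap_comp_conj_sub_one (n : ℕ) :
    (layerMap κ v u n).hom.toLinearMap ∘ₗ ((localLayerConj κ v T₁ n γ).hom.toLinearMap - 1) =
      ((localLayerConj κ v T₂ n γ).hom.toLinearMap - 1) ∘ₗ (layerMap κ v u n).hom.toLinearMap := by
  refine LinearMap.ext fun y ↦ ?_
  simp only [LinearMap.coe_comp, Function.comp_apply, LinearMap.sub_apply, Module.End.one_apply,
    map_sub]
  change layerMap κ v u n (localLayerConj κ v T₁ n γ y) - _ = _
  rw [layerMap_localLayerConj]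
  rfl

/-- A linear map intertwining two endomorphisms intertwines the polynomials in them. [folklore] -/
private theorem map_aeval_apply_of_comp_eq'' {N₁ N₂ : Type*} [AddCommGroup N₁] [Module ℤ_[p] N₁]
    [AddCommGroup N₂] [Module ℤ_[p] N₂]
    (g : N₁ →ₗ[ℤ_[p]] N₂) (a : Module.End ℤ_[p] N₁) (b : Module.End ℤ_[p] N₂)
    (h : g ∘ₗ a = b ∘ₗ g) (r : ℤ_[p][X]) (m : N₁) : g (aeval a r m) = aeval b r (g m) := by
  induction r using Polynomial.induction_on generalizing m with
  | C c => simp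
  | add f₁ f₂ h₁ h₂ => simp [h₁, h₂]
  | monomial k c hk =>
    have hc : ∀ m, g (a m) = b (g m) := fun m => by simpa using LinearMap.congr_fun h m
    rw [pow_succ, ← mul_assoc]
    conv_rhs => rw [map_mul, Module.End.mul_apply, aeval_X]
    conv_lhs => rw [map_mul, Module.End.mul_apply, aeval_X]
    rw [hk, hc]

/-- **Functoriality of `𝐇¹_loc` in `T`** (Kato §12.2; used in Lemma 17.9 / (17.13.3) for the ordinary
sub-lattice `T' ⊂ T`): for a `Γ_{ℚ_v}`-morphism `u : T₁ ⟶ T₂` and pinned local data `J₁`, `J₂` (same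
`κ`, `v`, `γ`), the map `𝐇¹(u) : J₁.H → J₂.H` sending the `Λ`-adic class of a norm-compatible family
`(y_n)_n` to that of `(H¹(u) y_n)_n` — well defined by `layerMap_localLayerCores`, characterised by
`proj_map`, unique (`map_unique`).  It is `Λ`-LINEAR: both actions are levelwise through `Λ/(ω_n)`
(`proj_smul`) and `H¹(u)_n` intertwines the level operators (`layerMap_comp_conj_sub_one`).
[cite: Kato2004Asterisque, §12.2 (p. 220) and Lemma 17.9 (p. 275)] -/
def map : J₁.H →ₗ[IwasawaAlgebra p] J₂.H where
  toFun x := (J₂.proj_surjective _ (J₁.isLocalNormCompatible_mapFamily u x)).choose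
  map_add' x x' := J₂.ext_of_proj fun n ↦ by
    rw [map_add, (J₂.proj_surjective _ (J₁.isLocalNormCompatible_mapFamily u (x + x'))).choose_spec,
      (J₂.proj_surjective _ (J₁.isLocalNormCompatible_mapFamily u x)).choose_spec,
      (J₂.proj_surjective _ (J₁.isLocalNormCompatible_mapFamily u x')).choose_spec,
      mapFamily_apply, mapFamily_apply, mapFamily_apply, map_add, map_add]
  map_smul' f x := J₂.ext_of_proj fun n ↦ by
    obtain ⟨r, hr⟩ := IwasawaH1Exists.exists_polynomial_sub_coe_mem_span p n f
    rw [RingHom.id_apply,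
      (J₂.proj_surjective _ (J₁.isLocalNormCompatible_mapFamily u (f • x))).choose_spec,
      J₂.proj_smul n hr,
      (J₂.proj_surjective _ (J₁.isLocalNormCompatible_mapFamily u x)).choose_spec,
      mapFamily_apply, mapFamily_apply, J₁.proj_smul n hr]
    exact map_aeval_apply_of_comp_eq'' (layerMap κ v u n).hom.toLinearMap _ _
      (layerMap_comp_conj_sub_one u n) r (J₁.proj n x)

/-- **The defining property of `𝐇¹(u)`**: it is computed levelwise,
`J₂.proj n (map x) = H¹(u)_n (J₁.proj n x)`. [cite: Kato2004Asterisque, §12.2 (p. 220)] -/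
theorem proj_map (n : ℕ) (x : J₁.H) :
    J₂.proj n (J₁.map u J₂ x) = layerMap κ v u n (J₁.proj n x) :=
  (J₂.proj_surjective _ (J₁.isLocalNormCompatible_mapFamily u x)).choose_spec n

/-- **Uniqueness of `𝐇¹(u)`**: any map `J₁.H → J₂.H` computed levelwise by the `H¹(u)_n` IS `map`.
[cite: Kato2004Asterisque, §12.2 (p. 220)] -/
theorem map_unique {f : J₁.H → J₂.H}
    (hf : ∀ (n : ℕ) (x : J₁.H), J₂.proj n (f x) = layerMap κ v u n (J₁.proj n x)) :
    f = J₁.map u J₂ :=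
  funext fun x ↦ J₂.ext_of_proj fun n ↦ by rw [hf, proj_map]

/-- **`𝐇¹(𝟙) = id`** (functoriality). [cite: Kato2004Asterisque, §12.2 (p. 220)] -/
theorem map_id_apply (x : J₁.H) : J₁.map (𝟙 T₁.toTopRep) J₁ x = x :=
  J₁.ext_of_proj fun n ↦ by rw [proj_map, layerMap_id_apply]

/-- **`𝐇¹(u ≫ u') = 𝐇¹(u') ∘ 𝐇¹(u)`** (functoriality). [cite: Kato2004Asterisque, §12.2 (p. 220)] -/
theorem map_comp_apply {M₃ : Type} [AddCommGroup M₃] [Module ℤ_[p] M₃] [TopologicalSpace M₃]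
    [IsTopologicalAddGroup M₃] [ContinuousSMul ℤ_[p] M₃] {T₃ : GaloisRep (v.adicCompletion ℚ) ℤ_[p] M₃}
    (J₃ : LocalIwasawaH1Data κ v T₃ γ) (u' : T₂.toTopRep ⟶ T₃.toTopRep) (x : J₁.H) :
    J₁.map (u ≫ u') J₃ x = J₂.map u' J₃ (J₁.map u J₂ x) :=
  J₃.ext_of_proj fun n ↦ by rw [proj_map, proj_map, proj_map, layerMap_comp_apply]

end LocalIwasawaH1Data

end Map

/-! ## §3 The ordinary sub-representation `T' = F⁺_v T_pW` of the local Tate module and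
`𝐇¹_loc(T') → 𝐇¹_loc(T)` -/

section Ordinary

variable (W : WeierstrassCurve ℚ) [W.IsElliptic] (p : ℕ) [Fact p.Prime]
  [ContinuousSMul ℤ_[p] (W.tateModule p)] (v : HeightOneSpectrum (𝓞 ℚ))

/-- **`T' = F⁺_v T_pW` as a representation of `Γ_{ℚ_v}`**: the sub-representation of the local Tate
representation `(T_pW)|_{Γ_{ℚ_v}} = (tateRep W p).toLocal v` on the `Γ_{ℚ_v}`-stable `ℤ_p`-submodule
`tateModuleFilAt W p v = T_p(E₁(ℚ̄_v))` (subspace topology; the tree's `ContinuousRep.subrepresentation`,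
stability `tateRep_toLocal_mem_tateModuleFilAt`).  At good ordinary `v ∣ p` this is Kato's `T'`
("`T, T', T''` as in 17.2", `T' = T ∩ V'`); the definition makes sense at every `v`.
[cite: Kato2004Asterisque, 17.2 (pp. 272–273) and §17.13 (17.13.3) (p. 279)] -/
def tateLocalOrdinaryRep : GaloisRep (v.adicCompletion ℚ) ℤ_[p] (tateModuleFilAt W p v) :=
  ((tateRep W p).toLocal v).subrepresentation (tateModuleFilAt W p v)
    fun g _ ha ↦ tateRep_toLocal_mem_tateModuleFilAt W p v g ha

/-- Unfolding `tateLocalOrdinaryRep`: it acts as `(T_pW)|_{Γ_{ℚ_v}}` on the underlying elements.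
[cite: Kato2004Asterisque, 17.2 (pp. 272–273)] -/
@[simp] theorem tateLocalOrdinaryRep_apply_coe (g : absoluteGaloisGroup (v.adicCompletion ℚ))
    (a : tateModuleFilAt W p v) :
    ((tateLocalOrdinaryRep W p v g a : tateModuleFilAt W p v) : W.tateModule p) =
      (tateRep W p).toLocal v g a :=
  rfl

/-- **The inclusion `T' ⟶ T`** of the ordinary sub-representation into the local Tate representation,
as a morphism of topological representations of `Γ_{ℚ_v}` (the subtype map, continuous and
equivariant). [cite: Kato2004Asterisque, Lemma 17.9 (p. 275)] -/
def tateLocalOrdinaryInclusion :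
    (tateLocalOrdinaryRep W p v).toTopRep ⟶ ((tateRep W p).toLocal v).toTopRep :=
  TopRep.ofHom ⟨(tateModuleFilAt W p v).subtypeL, fun _ ↦ rfl⟩

/-- `tateLocalOrdinaryInclusion` is the subtype inclusion on elements.
[cite: Kato2004Asterisque, Lemma 17.9 (p. 275)] -/
@[simp] theorem tateLocalOrdinaryInclusion_hom_apply (a : tateModuleFilAt W p v) :
    (tateLocalOrdinaryInclusion W p v).hom a = (a : W.tateModule p) := rfl

variable {W p v} {κ : ZpExtension ℚ p} {γᵥ : absoluteGaloisGroup (v.adicCompletion ℚ)}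

/-- **`𝐇¹_loc(T') → 𝐇¹_loc(T)`** for `T' = F⁺_v T_pW ⊂ T = (T_pW)|_{Γ_{ℚ_v}}` (the map Kato uses in
Lemma 17.9 / (17.13.3), whose image at good ordinary `p` is `lim← H¹_f(ℚ_{n,p}, T)`): the functorial
map `LocalIwasawaH1Data.map` along `tateLocalOrdinaryInclusion`, for pinned data `J'` of `T'` and `J`
of `T` (both exist: `nonempty_localIwasawaH1Data`).  `Λ`-linear; `J.proj n (ordinaryInclusion x) =
H¹(incl)_n (J'.proj n x)` (`LocalIwasawaH1Data.proj_map`).  Injectivity / the identification of the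
image (Lemma 17.9) are NOT asserted. [cite: Kato2004Asterisque, Lemma 17.9 (p. 275) and §17.13 (17.13.3) (p. 279)] -/
abbrev LocalIwasawaH1Data.ordinaryInclusion
    (J' : LocalIwasawaH1Data κ v (tateLocalOrdinaryRep W p v) γᵥ)
    (J : LocalIwasawaH1Data κ v ((tateRep W p).toLocal v) γᵥ) : J'.H →ₗ[IwasawaAlgebra p] J.H :=
  J'.map (tateLocalOrdinaryInclusion W p v) J

end Ordinary

end Literature.NumberTheory.EllipticCurves.Kato2004

end
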